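import Literature.NumberTheory.Transcendental.KZLogCalculusProofs
import Literature.NumberTheory.Transcendental.KZMellinFibres
import Literature.NumberTheory.Transcendental.KZDominatedFamilyRelations
import Summits.KontsevichZagierPeriods.KontsevichZagierPeriods.Theorems.HurwitzMicroSectorsNormalFormPrincipleLevelOneExistsRep

/-!
# `NormalFormPrinciple` (stmt-KontsevichZagierPeriods-3869), line `SketchIdeator1` — leaf `stub_boxRigidity`,
# dimension two off the product type (`FiveZetaTwoOffProduct`): the ζ(2) block

Registered sub-goal `logMonomialInv_sub_zetaBand` of the layer `FiveZetaTwoOffProduct`. The unfolded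
logarithmic monomial `L = [{0 < x < 1, 1 ≤ s ≤ 1/(1 − x)}, (1/x)/s]` (value
`∫₀¹ −log(1 − x)/x = ζ(2)`) and the band-box representation `Z = [{0 < x < 1, 0 ≤ θ ≤ 1}, 1/(1 − xθ)]`
differ by a relation of the Kontsevich–Zagier calculus (rule 2 only):

1. the fibrewise substitution `s = 1 + θ (v(x) − 1)`, `v(x) = 1/(1 − x)`
   (`KZ.of_sub_of_mem_relations_fibreSubst`) carries `L` to the auxiliary band-box representation
   `Zc = [{0 < x < 1, 0 ≤ θ ≤ 1}, 1/(1 − x(1 − θ))]`, by the identity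
   `(1/x) (v − 1)/(1 + θ (v − 1)) = 1/(1 − x + θx)`;
2. the reflection `θ ↦ 1 − θ` of the last coordinate (`KZ.boxReflection 1`,
   `KZ.of_sub_of_mem_relations_of_boxReflection`) carries `Zc` to `Z`; the absolute convergence of
   `Zc` is that of `Z` transported along the reflection (Jacobian of absolute value `1`,
   `MeasureTheory.integrableOn_image_iff_integrableOn_abs_det_fderiv_smul`).

References: M. Kontsevich, D. Zagier, *Periods* (2001), §1.2 rule (2). No definitions are
introduced.
-/

noncomputable section

open MeasureTheory Set
open Literature.NumberTheory.Transcendental Literature.NumberTheory.Transcendental.KZ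
open Literature.ModelTheory.ExponentialFields (IsSemialgebraic)

namespace Summit.KontsevichZagierPeriods.HurwitzMicroSectors.NormalFormPrinciple.PiBox.M2

/-- The band-box `{0 < x < 1, 0 ≤ θ ≤ 1}` is invariant under the reflection `θ ↦ 1 − θ`.
[folklore] -/
theorem zetaBand_preimage_boxReflection :
    boxReflection 1 ⁻¹'
        KZlog.band {y : Fin 1 → ℝ | 0 < y 0 ∧ y 0 < 1} (fun _ => (0:ℝ)) (fun _ => (1:ℝ)) =
      KZlog.band {y : Fin 1 → ℝ | 0 < y 0 ∧ y 0 < 1} (fun _ => (0:ℝ)) (fun _ => (1:ℝ)) := by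
  ext z
  show (0 < boxReflection 1 z 0 ∧ boxReflection 1 z 0 < 1) ∧ 0 ≤ boxReflection 1 z 1 ∧
      boxReflection 1 z 1 ≤ 1 ↔ (0 < z 0 ∧ z 0 < 1) ∧ 0 ≤ z 1 ∧ z 1 ≤ 1
  rw [boxReflection_apply_of_ne (show (0 : Fin 2) ≠ 1 by decide), boxReflection_apply_self]
  constructor
  · rintro ⟨h0, h1, h2⟩
    exact ⟨h0, by linarith, by linarith⟩
  · rintro ⟨h0, h1, h2⟩
    exact ⟨h0, by linarith, by linarith⟩

/-- On the band-box `{0 < x < 1, 0 ≤ θ ≤ 1}` the reflected kernel denominator `1 − x(1 − θ)` is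
positive. [folklore] -/
theorem zetaBand_one_sub_mul_one_sub_pos {z : Fin 2 → ℝ}
    (hz : z ∈ KZlog.band {y : Fin 1 → ℝ | 0 < y 0 ∧ y 0 < 1} (fun _ => (0:ℝ)) (fun _ => (1:ℝ))) :
    0 < 1 - z 0 * (1 - z 1) := by
  have h : (0 < z 0 ∧ z 0 < 1) ∧ 0 ≤ z 1 ∧ z 1 ≤ 1 := hz
  have h01 : z 0 * (1 - z 1) ≤ z 0 * 1 :=
    mul_le_mul_of_nonneg_left (by linarith [h.2.1]) h.1.1.le
  linarith [h.1.2]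

/-- The pull-back identity of the fibrewise substitution `s = 1 + θ (v − 1)`, `v = 1/(1 − x)`:
`1/(1 − x(1 − θ)) = (1/x)(v − 1)/(1 + θ(v − 1))` for `0 < x < 1`, `0 ≤ θ`. [folklore] -/
theorem zetaBand_fibreSubst_identity {x θ : ℝ} (hx0 : 0 < x) (hx1 : x < 1) (hθ0 : 0 ≤ θ) :
    1 / (1 - x * (1 - θ)) = 1 / x * (1 / (1 - x) - 1) / (1 + θ * (1 / (1 - x) - 1)) := by
  have hx : x ≠ 0 := hx0.ne'
  have h1x : 1 - x ≠ 0 := (sub_pos.2 hx1).ne'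
  have hd : 1 - x * (1 - θ) ≠ 0 := by
    have : 0 < 1 - x + θ * x := by nlinarith
    intro h
    linarith [show 1 - x * (1 - θ) = 1 - x + θ * x by ring]
  have e1 : 1 / (1 - x) - 1 = x / (1 - x) := by
    field_simp
    ring
  have e2 : 1 + θ * (x / (1 - x)) = (1 - x * (1 - θ)) / (1 - x) := by
    field_simp
    ring
  rw [e1, e2]
  field_simp

/-- **Stub Z (the ζ(2) block: fibre substitution + reflection, Kontsevich–Zagier rule 2).**
The unfolded logarithmic monomial `M(1/x, 1/(1 − x)) = [{0 < x < 1, 1 ≤ s ≤ 1/(1 − x)}, (1/x)/s]`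
(value `ζ(2)`) and the band-box representation `[{0 < x < 1, 0 ≤ θ ≤ 1}, 1/(1 − xθ)]` differ by a
relation: the fibrewise substitution `s = 1 + θ(v − 1)` with `v = 1/(1 − x)`
(`KZ.of_sub_of_mem_relations_fibreSubst`) lands on `[band-box, 1/(1 − x(1 − θ))]`, and the reflection
`θ ↦ 1 − θ` (`KZ.of_sub_of_mem_relations_of_boxReflection`) on `[band-box, 1/(1 − xθ)]`.
[cite: KontsevichZagier2001, §1.2 rule (2)] -/
theorem logMonomialInv_sub_zetaBand (L Z : IntegralRep 2)
    (hLd : L.domain = KZlog.band {y : Fin 1 → ℝ | 0 < y 0 ∧ y 0 < 1} (fun _ => (1:ℝ)) (fun y => 1 / (1 - y 0)))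
    (hLi : EqOn L.integrand (fun z => (1 / z 0) / z 1) L.domain)
    (hZd : Z.domain = KZlog.band {y : Fin 1 → ℝ | 0 < y 0 ∧ y 0 < 1} (fun _ => (0:ℝ)) (fun _ => (1:ℝ)))
    (hZi : EqOn Z.integrand (fun z => 1 / (1 - z 0 * z 1)) Z.domain) :
    of L - of Z ∈ relations := by
  -- the open base `(0,1) ⊆ ℝ¹` and the band-box over it
  have hG : IsSemialgebraic ℚ {y : Fin 1 → ℝ | 0 < y 0 ∧ y 0 < 1} :=
    isSemialgebraic_unitInterval_fin_one
  have hB : IsSemialgebraic ℚ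
      (KZlog.band {y : Fin 1 → ℝ | 0 < y 0 ∧ y 0 < 1} (fun _ => (0:ℝ)) (fun _ => (1:ℝ))) :=
    KZlog.isSemialgebraic_band (by simpa using isSemialgebraicFunOn_ratCast hG 0)
      (by simpa using isSemialgebraicFunOn_ratCast hG 1)
  have hBm : MeasurableSet
      (KZlog.band {y : Fin 1 → ℝ | 0 < y 0 ∧ y 0 < 1} (fun _ => (0:ℝ)) (fun _ => (1:ℝ))) :=
    Literature.ModelTheory.ExponentialFields.IsSemialgebraic.measurableSet_holds hB
  -- the reflected kernel `1/(1 − x(1 − θ))` is semialgebraic on the band-box ...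
  have hsa : IsSemialgebraicFunOn ℚ
      (KZlog.band {y : Fin 1 → ℝ | 0 < y 0 ∧ y 0 < 1} (fun _ => (0:ℝ)) (fun _ => (1:ℝ)))
      (fun z => 1 / (1 - z 0 * (1 - z 1))) := by
    refine (isSemialgebraicFunOn_aeval_div_aeval hB 1
      (1 - MvPolynomial.X 0 * (1 - MvPolynomial.X 1)) fun x hx => ?_).congr fun x _ => by simp
    simp only [map_sub, map_mul, map_one, MvPolynomial.aeval_X]
    exact (zetaBand_one_sub_mul_one_sub_pos hx).ne'
  -- ... and integrable there: transport of the integrability of `Z` along the reflection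
  have hZint : IntegrableOn (fun z : Fin 2 → ℝ => 1 / (1 - z 0 * z 1))
      (KZlog.band {y : Fin 1 → ℝ | 0 < y 0 ∧ y 0 < 1} (fun _ => (0:ℝ)) (fun _ => (1:ℝ))) := by
    have h := Z.integrableOn.congr_fun hZi (IntegralRep.measurableSet_domain_holds Z)
    rwa [hZd] at h
  obtain ⟨Lr, hdet, hLr⟩ := exists_hasFDerivAt_boxReflection (1 : Fin 2)
  have himg : boxReflection 1 ''
        KZlog.band {y : Fin 1 → ℝ | 0 < y 0 ∧ y 0 < 1} (fun _ => (0:ℝ)) (fun _ => (1:ℝ)) =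
      KZlog.band {y : Fin 1 → ℝ | 0 < y 0 ∧ y 0 < 1} (fun _ => (0:ℝ)) (fun _ => (1:ℝ)) := by
    conv_lhs => rw [← zetaBand_preimage_boxReflection]
    exact image_preimage_eq _ (boxReflection_involutive 1).surjective
  have hint : IntegrableOn (fun z : Fin 2 → ℝ => 1 / (1 - z 0 * (1 - z 1)))
      (KZlog.band {y : Fin 1 → ℝ | 0 < y 0 ∧ y 0 < 1} (fun _ => (0:ℝ)) (fun _ => (1:ℝ))) := by
    have key := (integrableOn_image_iff_integrableOn_abs_det_fderiv_smul volume hBm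
      (f' := fun _ => Lr) (fun x _ => (hLr x).hasFDerivWithinAt)
      (boxReflection_involutive 1).injective.injOn
      (fun z : Fin 2 → ℝ => 1 / (1 - z 0 * z 1))).1 (by rw [himg]; exact hZint)
    refine key.congr_fun (fun x _ => ?_) hBm
    simp only [hdet, one_smul, boxReflection_apply_self,
      boxReflection_apply_of_ne (show (0 : Fin 2) ≠ 1 by decide)]
  -- the auxiliary representation `Zc = [band-box, 1/(1 − x(1 − θ))]`
  obtain ⟨Zc, hcd, hci⟩ : ∃ Zc : IntegralRep 2,
      Zc.domain = KZlog.band {y : Fin 1 → ℝ | 0 < y 0 ∧ y 0 < 1} (fun _ => (0:ℝ)) (fun _ => (1:ℝ)) ∧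
      Zc.integrand = fun z => 1 / (1 - z 0 * (1 - z 1)) :=
    ⟨⟨_, _, hB, hsa, hint⟩, rfl, rfl⟩
  -- (rule 2, fibrewise substitution `s = 1 + θ (v − 1)`, `v = 1/(1 − x)`) `L` versus `Zc`
  have hv : IsSemialgebraicFunOn ℚ {y : Fin 1 → ℝ | 0 < y 0 ∧ y 0 < 1}
      (fun y => 1 / (1 - y 0)) := by
    refine (isSemialgebraicFunOn_aeval_div_aeval hG 1 (1 - MvPolynomial.X 0)
      fun y hy => ?_).congr fun y _ => by simp
    have h : 0 < y 0 ∧ y 0 < 1 := hy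
    simp only [map_sub, map_one, MvPolynomial.aeval_X]
    exact (sub_pos.2 h.2).ne'
  have hv1 : ∀ y ∈ {y : Fin 1 → ℝ | 0 < y 0 ∧ y 0 < 1}, (1:ℝ) ≤ 1 / (1 - y 0) := by
    intro y hy
    have h : 0 < y 0 ∧ y 0 < 1 := hy
    exact one_le_one_div (sub_pos.2 h.2) (by linarith [h.1])
  have e1 : of L - of Zc ∈ relations := by
    refine of_sub_of_mem_relations_fibreSubst (m := 1) (f := fun y => 1 / y 0)
      (v := fun y => 1 / (1 - y 0)) hG hv hv1 L Zc hLd (fun z hz => hLi hz) hcd fun z hz => ?_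
    rw [hcd] at hz
    have h : (0 < z 0 ∧ z 0 < 1) ∧ 0 ≤ z 1 ∧ z 1 ≤ 1 := hz
    rw [hci]
    show 1 / (1 - z 0 * (1 - z 1)) =
      1 / z 0 * (1 / (1 - z 0) - 1) / (1 + z 1 * (1 / (1 - z 0) - 1))
    exact zetaBand_fibreSubst_identity h.1.1 h.1.2 h.2.1
  -- (rule 2, reflection `θ ↦ 1 − θ`) `Zc` versus `Z`
  have e2 : of Zc - of Z ∈ relations := by
    refine of_sub_of_mem_relations_of_boxReflection (1 : Fin 2) ?_ fun x hx => ?_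
    · rw [hcd, hZd, zetaBand_preimage_boxReflection]
    · have hx' : boxReflection 1 x ∈ Z.domain := by
        rw [hZd, ← mem_preimage, zetaBand_preimage_boxReflection, ← hcd]
        exact hx
      rw [hZi hx', hci]
      simp only [boxReflection_apply_self,
        boxReflection_apply_of_ne (show (0 : Fin 2) ≠ 1 by decide)]
  -- bookkeeping
  have e : of L - of Z = (of L - of Zc) + (of Zc - of Z) := by abel
  rw [e]
  exact relations.add_mem e1 e2

end Summit.KontsevichZagierPeriods.HurwitzMicroSectors.NormalFormPrinciple.PiBox.M2
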